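import Summits.Ventures.PercRepro.RLSRuleTwoLinesAny
import Summits.Ventures.PercRepro.RLSRuleOneLine
import Summits.Ventures.PercRepro.RLSRuleLineFreeMain

/-!
# PercRepro — `R₃⁺` at `t = 0`: every simple plane with at most two `3`-point lines, every `p ≥ 8` (night-3, gen 3)

The three families `perFlat_lineFree_of_typeZero`, `perFlat_oneLine`, `perFlat_twoLinesAny` in ONE statement: on a
simple plane `G` whose dependent triples (`depTriples M G`, the `3`-point lines — on a simple plane a dependent
triple has rank exactly `2`) number at most two, the per-flat inequality of `R₃⁺` holds at `(p, 3)` for every `p ≥ 8`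
whenever `ρ(E ∖ G) ≥ p` (type `0`).

* `depTriples`, `eRk_eq_two_of_dep_triple`, `lineFree_of_depTriples_empty`, `oneLine_of_depTriples_singleton`,
  `twoLinesAny_of_depTriples_pair`;
* **`perFlat_typeZero_of_depTriples_le_two`**, `simpleOn_of_core`, `perFlat_typeZero_of_core` (on `Core M p`, simplicity automatic).
Imports `RLSRuleTwoLinesAny`, `RLSRuleOneLine`, `RLSRuleLineFreeMain`.  Axioms: standard.
-/

open scoped Matroid

namespace PercRepro

namespace NightThree

open Finset ThmH PerFlat

variable {α : Type*} [DecidableEq α] {M : Matroid α} [M.Finite]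

open scoped Classical in
/-- The dependent triples of `G` (its `3`-point lines on a simple plane). -/
noncomputable def depTriples (M : Matroid α) (G : Finset α) : Finset (Finset α) :=
  (G.powersetCard 3).filter (fun T => ¬ M.Indep (T : Set α))

omit [M.Finite] in
/-- On a simple set a dependent triple has rank `2`. -/
theorem eRk_eq_two_of_dep_triple {G T : Finset α} (hsimple : SimpleOn M G) (hT : T ⊆ G) (hTc : T.card = 3)
    (hdep : ¬ M.Indep (T : Set α)) : M.eRk (T : Set α) = 2 := by
  obtain ⟨P, hPT, hPc⟩ := Finset.exists_subset_card_eq (show 2 ≤ T.card by omega)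
  obtain ⟨u, v, huv, rfl⟩ := Finset.card_eq_two.1 hPc
  have hPr : M.eRk (({u, v} : Finset α) : Set α) = 2 := by
    rw [Finset.coe_pair]
    exact hsimple u (hT (hPT (by simp))) v (hT (hPT (by simp))) huv
  apply le_antisymm
  · -- rank `≤ 2`: a rank-`3` triple would be independent
    by_contra h
    push Not at h
    have h3 : M.eRk (T : Set α) = 3 := by
      apply le_antisymm
      · have := M.eRk_le_encard (T : Set α)
        rwa [Set.encard_coe_eq_coe_finsetCard, hTc] at this
      · exact Order.add_one_le_of_lt h
    exact hdep ((Matroid.indep_iff_eRk_eq_encard_of_finite T.finite_toSet).2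
      (by rw [h3, Set.encard_coe_eq_coe_finsetCard, hTc]; rfl))
  · rw [← hPr]
    exact M.eRk_mono (Finset.coe_subset.2 hPT)

omit [DecidableEq α] [M.Finite] in
/-- No dependent triple: line-free. -/
theorem lineFree_of_depTriples_empty {G : Finset α} (h : depTriples M G = ∅) : LineFree M G := by
  classical
  intro T hT
  by_contra hdep
  have : T ∈ depTriples M G := by
    unfold depTriples
    rw [Finset.mem_filter]
    exact ⟨hT, hdep⟩
  rw [h] at this
  exact absurd this (Finset.notMem_empty T)

omit [DecidableEq α] [M.Finite] in
/-- One dependent triple: `OneLine`. -/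
theorem oneLine_of_depTriples_singleton {G ℓ : Finset α} (hsimple : SimpleOn M G)
    (h : depTriples M G = {ℓ}) : OneLine M G ℓ := by
  classical
  have hℓ : ℓ ∈ depTriples M G := by rw [h]; exact Finset.mem_singleton_self ℓ
  unfold depTriples at hℓ
  rw [Finset.mem_filter, Finset.mem_powersetCard] at hℓ
  refine ⟨hℓ.1.1, hℓ.1.2, eRk_eq_two_of_dep_triple hsimple hℓ.1.1 hℓ.1.2 hℓ.2, ?_⟩
  intro T hT hne
  by_contra hdep
  have : T ∈ depTriples M G := by
    unfold depTriples
    rw [Finset.mem_filter]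
    exact ⟨hT, hdep⟩
  rw [h, Finset.mem_singleton] at this
  exact hne this

omit [M.Finite] in
/-- Two dependent triples: `TwoLinesAny`. -/
theorem twoLinesAny_of_depTriples_pair {G ℓ ℓ' : Finset α} (hsimple : SimpleOn M G) (hne : ℓ ≠ ℓ')
    (h : depTriples M G = {ℓ, ℓ'}) : TwoLinesAny M G ℓ ℓ' := by
  classical
  have hℓ : ℓ ∈ depTriples M G := by rw [h]; exact Finset.mem_insert_self _ _
  have hℓ' : ℓ' ∈ depTriples M G := by rw [h]; exact Finset.mem_insert_of_mem (Finset.mem_singleton_self _)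
  unfold depTriples at hℓ hℓ'
  rw [Finset.mem_filter, Finset.mem_powersetCard] at hℓ hℓ'
  refine ⟨hℓ.1.1, hℓ'.1.1, hℓ.1.2, hℓ'.1.2, eRk_eq_two_of_dep_triple hsimple hℓ.1.1 hℓ.1.2 hℓ.2,
    eRk_eq_two_of_dep_triple hsimple hℓ'.1.1 hℓ'.1.2 hℓ'.2, hne, hsimple, ?_⟩
  intro T hT hne1 hne2
  by_contra hdep
  have : T ∈ depTriples M G := by
    unfold depTriples
    rw [Finset.mem_filter]
    exact ⟨hT, hdep⟩
  rw [h, Finset.mem_insert, Finset.mem_singleton] at this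
  rcases this with h1 | h1
  · exact hne1 h1
  · exact hne2 h1

/-- **`R₃⁺` at `t = 0` on every simple plane with at most two `3`-point lines**, every `p ≥ 8`: for `G` a plane,
simple on `G`, with `#depTriples M G ≤ 2` and `ρ(E ∖ G) ≥ p`, `Φ(p, 3) · #U_G ≤ Σ_{S ∈ Yq} w⁺(G, S)`. -/
theorem perFlat_typeZero_of_depTriples_le_two {G : Finset α} (hG : G ∈ flatsQ M 3) (hsimple : SimpleOn M G)
    (hdep : (depTriples M G).card ≤ 2) {p : ℕ} (hp : 8 ≤ p)
    (hK : (p : ℕ∞) ≤ M.eRk ((gr M \ G : Finset α) : Set α)) :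
    phiK p 3 * ((UqG M p 3 G).card : ℚ) ≤ ∑ S ∈ Yq M p 3, wPlus M G S := by
  classical
  obtain ⟨n, rfl⟩ : ∃ n, p = n + 4 := ⟨p - 4, by omega⟩
  have hn : 4 ≤ n := by omega
  rcases Nat.lt_or_ge (depTriples M G).card 1 with h0 | h1
  · have hemp : depTriples M G = ∅ := Finset.card_eq_zero.1 (by omega)
    exact perFlat_lineFree_of_typeZero hG (lineFree_of_depTriples_empty hemp) (n + 4) hK
  rcases Nat.lt_or_ge (depTriples M G).card 2 with h1' | h2
  · obtain ⟨ℓ, hℓ⟩ := Finset.card_eq_one.1 (by omega : (depTriples M G).card = 1)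
    exact perFlat_oneLine hG (oneLine_of_depTriples_singleton hsimple hℓ) hn hK
  · obtain ⟨ℓ, ℓ', hne, hℓℓ'⟩ := Finset.card_eq_two.1 (by omega : (depTriples M G).card = 2)
    exact perFlat_twoLinesAny hG (twoLinesAny_of_depTriples_pair hsimple hne hℓℓ') hn hK

omit [DecidableEq α] in
/-- On a core matroid every subset of the ground set is simple. -/
theorem simpleOn_of_core {p : ℕ} (hc : Core M p) {G : Finset α} (hG : G ⊆ gr M) : SimpleOn M G := by
  intro u hu v hv huv
  exact hc.1 u (by rw [← coe_gr M]; exact Finset.mem_coe.2 (hG hu)) v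
    (by rw [← coe_gr M]; exact Finset.mem_coe.2 (hG hv)) huv

/-- The wrapper on a core matroid of rank `p ≥ 8` (simplicity is automatic): every plane with at most two `3`-point
lines and `ρ(E ∖ G) ≥ p` satisfies the per-flat inequality of `R₃⁺`. -/
theorem perFlat_typeZero_of_core {p : ℕ} (hc : Core M p) {G : Finset α} (hG : G ∈ flatsQ M 3)
    (hdep : (depTriples M G).card ≤ 2) (hp : 8 ≤ p)
    (hK : (p : ℕ∞) ≤ M.eRk ((gr M \ G : Finset α) : Set α)) :
    phiK p 3 * ((UqG M p 3 G).card : ℚ) ≤ ∑ S ∈ Yq M p 3, wPlus M G S :=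
  perFlat_typeZero_of_depTriples_le_two hG (simpleOn_of_core hc (mem_flatsQ.1 hG).1) hdep hp hK

end NightThree

end PercRepro
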